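import Summits.AtomisticToContinuum.HydrodynamicLimit.Theses.JParityClosure
import HarnessLib

/-!
# Young-measure mixing obstruction to the parity mechanism with FIXED odd marks (two-fibre counter-model)

Negative-side evidence for the crux `JParityClosure.ParityBandClosure` (stmt-AtomisticToContinuum-17608), line
`Sketch`, stub `stub_maxwellDefectVanishes` (lead's cycle 2; prose in `Cruxes/ParityBandClosure/Lines/Sketch.dead.md`).
This is a TOY MODEL of the limit identities, kernel-checked; it refutes a proof strategy, not the crux.

THE POINT. The line's kinetic half wants: (balance) `∫ F dκ = 0` for the surprisal jump `F` of the limit collision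
record `κ`, plus (`OddContactSymmetry`, stmt-17722, as typed) `J`-symmetry of the Metropolis-reweighted record
`min(1,e^{−F})·κ` tested against bounded continuous `J`-odd marks `Ψ(n̂, v, w)` ⟹ detailed balance `F = 0` on the
record (zero Metropolis rejection mass, `MaxwellDefectVanishesInBand`). Fibrewise this is the landed
`stub_detailedBalanceOfSymmetricRecord` (p138663). But the route's hypotheses carry FIXED test functions `χ(s,x)`,
`Ψ(n̂,v,w)` with `N`-independent tolerances, so after `N → ∞, r → 0` they constrain only the record SUMMED over the
Young-measure fibres of the local velocity law (mesoscopic cells of different laws at scales between `r` and `1`),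
while `F` is computed in each cell from that cell's own law. Summed `J`-symmetry + (even fibrewise) balance do NOT
give detailed balance: below, two fibres on the two-point record space `Bool` with `J = not`, uniform records, jumps
`F₁ = (+1 on true, −1 on false)` and `F₂ = −F₁` — both `J`-odd, both balanced, the summed reweighted record
annihilates EVERY `J`-odd mark, yet each fibre rejects mass `1 − e⁻¹`. The same two fibres ARE detected by an odd
test of the jump value itself (`φ(F) = F`: the summed reweighted first moment is `2(e⁻¹ − 1) ≠ 0`), which is why the
mixing-proof lemma `ParityBandClosureDetailedBalance.ae_eq_zero_of_balance_of_odd_jump_tests` (this cycle) asks for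
odd tests OF `F` — the repair of 17722 recommended to the planner.
-/

noncomputable section

namespace Summit.AtomisticToContinuum.HydrodynamicLimit.Theorems.ParityBandClosureNegative

open scoped BigOperators

/-- `min(1, e^{−1}) = e^{−1}`. [folklore] -/
theorem min_one_exp_neg_one : min 1 (Real.exp (-1)) = Real.exp (-1) :=
  min_eq_right (Real.exp_le_one_iff.2 (by norm_num))

/-- `min(1, e) = 1`. [folklore] -/
theorem min_one_exp_one : min 1 (Real.exp 1) = 1 :=
  min_eq_left (Real.one_le_exp_iff.2 (by norm_num))

/-- `0 < 1 − e^{−1}`. [folklore] -/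
theorem one_sub_exp_neg_one_pos : 0 < 1 - Real.exp (-1) := by
  rw [sub_pos, ← Real.exp_zero]
  exact Real.exp_lt_exp.2 (by norm_num)

/-- **Two-fibre counter-model (Young mixing defeats fixed odd marks).** On the record space `Bool` with the
involution `J = not` (inverse collision), take two fibres with uniform records (mass `1` per point) and surprisal
jumps `F₁ b = bif b then 1 else −1`, `F₂ = −F₁`; `w = min(1, e^{−·})` is the Metropolis acceptance. Then:
(i) both jumps are `J`-odd; (ii) each fibre is balanced (`∑ F = 0`); (iii) the fibre-SUMMED reweighted record
annihilates every `J`-odd mark `Ψ` (what `OddContactSymmetry` with fixed marks yields after mixing); (iv) the total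
rejection mass is `2(1 − e⁻¹) > 0` — no detailed balance in either fibre; (v) fibrewise `J`-symmetry indeed fails
(the odd mark `Ψ b = if b then 1 else −1` sees `e⁻¹ − 1 ≠ 0` on fibre 1); (vi) the odd test OF THE JUMP `φ(F) = F`
detects the pair even after summation: `∑ F₁ w(F₁) + ∑ F₂ w(F₂) = 2(e⁻¹ − 1) ≠ 0`. [folklore] -/
theorem youngMixing_twoFibre_counterModel : let J : Bool → Bool := not; let F₁ : Bool → ℝ := fun b => bif b then 1 else -1; let F₂ : Bool → ℝ := fun b => bif b then -1 else 1; let w : ℝ → ℝ := fun f => min 1 (Real.exp (-f)); (∀ b, F₁ (J b) = -F₁ b) ∧ (∀ b, F₂ (J b) = -F₂ b) ∧ (∀ b, F₂ b = -F₁ b) ∧ (∑ b, F₁ b = 0) ∧ (∑ b, F₂ b = 0) ∧ (∀ Ψ : Bool → ℝ, (∀ b, Ψ (J b) = -Ψ b) → (∑ b, Ψ b * w (F₁ b)) + (∑ b, Ψ b * w (F₂ b)) = 0) ∧ ((∑ b, (1 - w (F₁ b))) + (∑ b, (1 - w (F₂ b))) = 2 * (1 - Real.exp (-1))) ∧ (0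 < 2 * (1 - Real.exp (-1))) ∧ ((∑ b, (if b then (1 : ℝ) else -1) * w (F₁ b)) = Real.exp (-1) - 1) ∧ (Real.exp (-1) - 1 ≠ 0) ∧ ((∑ b, F₁ b * w (F₁ b)) + (∑ b, F₂ b * w (F₂ b)) = 2 * (Real.exp (-1) - 1)) := by
  intro J F₁ F₂ w
  have hpos := one_sub_exp_neg_one_pos
  have a1 : F₁ true = 1 := rfl
  have a2 : F₁ false = -1 := rfl
  have b1 : F₂ true = -1 := rfl
  have b2 : F₂ false = 1 := rfl
  have w1 : w 1 = Real.exp (-1) := min_one_exp_neg_one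
  have w2 : w (-1) = 1 := by
    show min 1 (Real.exp (-(-1))) = 1
    rw [neg_neg]
    exact min_one_exp_one
  refine ⟨?_, ?_, ?_, ?_, ?_, ?_, ?_, by positivity, ?_, by linarith, ?_⟩
  · intro b; cases b <;> simp [J, F₁]
  · intro b; cases b <;> simp [J, F₂]
  · intro b; cases b <;> simp [F₁, F₂]
  · rw [Fintype.sum_bool, a1, a2]; ring
  · rw [Fintype.sum_bool, b1, b2]; ring
  · intro Ψ hΨ
    have h : Ψ false = -Ψ true := hΨ true
    rw [Fintype.sum_bool, Fintype.sum_bool, a1, a2, b1, b2, w1, w2, h]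
    ring
  · rw [Fintype.sum_bool, Fintype.sum_bool, a1, a2, b1, b2, w1, w2]
    ring
  · rw [Fintype.sum_bool, a1, a2, w1, w2]
    simp only [if_true, Bool.false_eq_true, if_false]
    ring
  · rw [Fintype.sum_bool, Fintype.sum_bool, a1, a2, b1, b2, w1, w2]
    ring

end Summit.AtomisticToContinuum.HydrodynamicLimit.Theorems.ParityBandClosureNegative

end
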